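import Summits.ResolutionOfSingularities.ResolutionOfSingularities.Theorems.FrobeniusLadderFRationalResolutionTightClosureExchange
import Summits.ResolutionOfSingularities.ResolutionOfSingularities.Theorems.FrobeniusLadderFRationalResolutionTightClosurePowerStep
import Summits.ResolutionOfSingularities.ResolutionOfSingularities.Theorems.FrobeniusLadderFRationalResolutionSocleCyclicOfOne
import Literature.RingTheory.RegularLocalRing.ParameterIdealSocle
import Literature.RingTheory.TightClosure.TightClosure
import HarnessLib

/-!
# F-rationality is detected by ONE system of parameters (Cohen–Macaulay local rings)

Route `FrobeniusLadder`, crux stmt-ResolutionOfSingularities-15317 `FRationalResolution`, line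
`Sketch`, continuation seat c3, wave 3, theme (O). The Cohen–Macaulay case of Hochster–Huneke 1994,
Thm. 4.2 (d) / Prop. 6.27 (a) (named fact
`Literature.RingTheory.TightClosure.HochsterHuneke1994_prop627a`; Fedder–Watanabe 1989 §2), with an
ELEMENTARY proof — no local cohomology, no test elements, no transition determinants:

* `isTightlyClosed_exchange` — if `(C, a, A)` and `(C, g, A)` are parameter lists of a Noetherian
  local ring of characteristic `p` all of whose parameter lists are weakly regular, and `(C, a, A)`
  is tightly closed, then so is `(C, g, A)`: `a` is regular modulo every Frobenius power of
  `J = (C, A)` (these are again parameter ideals), so `(J, a^M)` is tightly closed for all `M`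
  (`stub_tc_power_step`), and `a^M ∈ (J, g)` for `M ≫ 0` gives `(J, g)` tightly closed
  (`stub_tc_exchange`);
* `isTightlyClosed_of_append` — the exchange chain (as in `stub_socle_cyclic_of_one`): two
  parameter lists with a common prefix are simultaneously tightly closed;
* `isTightlyClosed_parameterIdeal_of_one` — **if ONE parameter ideal is tightly closed then EVERY
  parameter ideal is** (for such rings);
* `fRationalClause_of_one` — the same in the crux's vocabulary: a Noetherian local DOMAIN of
  characteristic `p` in which every system of parameters is a weakly regular sequence (rung 2's
  Cohen–Macaulay clause) and ONE system of parameters generates an ideal satisfying the tight-closure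
  clause satisfies the F-rational clause of `FRationalModification` / `FRationalResolution`.

## References

* M. Hochster, C. Huneke, *F-regularity, test elements, and smooth base change*, Trans. AMS 346
  (1994), Thm. 4.2 (d), Prop. 6.27 (a). [HochsterHuneke1994]
* R. Fedder, K.-i. Watanabe, *A characterization of F-regularity in terms of F-purity*, MSRI Publ.
  15 (1989), §2. [FedderWatanabe1989]
-/

-- single-problem summit: the doubled namespace component is forced
set_option linter.dupNamespace false

open IsLocalRing RingTheory.Sequence Literature.RingTheory.TightClosure
open Literature.RingTheory.RegularLocalRing (ofList_append_cons ofList_concat)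

namespace Summit.ResolutionOfSingularities.ResolutionOfSingularities.Theorems.FRationalResolution

/-- Frobenius powers of the ideal of a list: `(x₁, …, xₙ)^[q] = (x₁^q, …, xₙ^q)`. [folklore] -/
theorem frobeniusPower_ofList {R : Type} [CommRing R] (p : ℕ) [ExpChar R p] (e : ℕ) (L : List R) :
    frobeniusPower (p ^ e) (Ideal.ofList L) = Ideal.ofList (L.map fun x => x ^ p ^ e) := by
  rw [Ideal.ofList, frobeniusPower_span, Ideal.ofList]
  congr 1
  ext y
  simp only [Set.mem_image, Set.mem_setOf_eq, List.mem_map]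

/-- A parameter list stays `𝔪`-primary when its members are replaced by powers and one member is
appended unchanged: if `𝔪^N ≤ (B, a)` then some power of `𝔪` lies in `(B^q, a)`. [folklore] -/
theorem exists_pow_le_ofList_map_pow_concat {R : Type} [CommRing R] [IsNoetherianRing R]
    [IsLocalRing R] (B : List R) (a : R) {N : ℕ} (hN : maximalIdeal R ^ N ≤ Ideal.ofList (B ++ [a]))
    (q : ℕ) :
    ∃ N' : ℕ, maximalIdeal R ^ N' ≤ Ideal.ofList (B.map (fun x => x ^ q) ++ [a]) := by
  refine Ideal.exists_pow_le_of_le_radical_of_fg ?_ (IsNoetherian.noetherian _)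
  -- `𝔪 ≤ rad (B, a) ≤ rad (B^q, a)`
  have h1 : maximalIdeal R ≤ (Ideal.ofList (B ++ [a])).radical := fun x hx =>
    ⟨N, hN (Ideal.pow_mem_pow hx N)⟩
  refine h1.trans ?_
  refine Ideal.radical_le_radical_iff.mpr ?_
  rw [Ideal.ofList, Ideal.span_le]
  intro x hx
  simp only [List.mem_append, List.mem_singleton, Set.mem_setOf_eq] at hx
  rcases hx with hx | rfl
  · refine ⟨q, Ideal.subset_span ?_⟩
    simp only [List.mem_append, List.mem_map, List.mem_singleton, Set.mem_setOf_eq]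
    exact Or.inl ⟨x, hx, rfl⟩
  · refine Ideal.le_radical (Ideal.subset_span ?_)
    simp only [List.mem_append, List.mem_map, List.mem_singleton, Set.mem_setOf_eq]
    exact Or.inr trivial

/-- **One exchange preserves tight closedness.** Let `R` be a Noetherian local ring of prime
characteristic `p` all of whose parameter lists (lists of `dim R` elements of `𝔪` generating an
`𝔪`-primary ideal) are weakly regular sequences. If `(C, a, A)` is a parameter list whose ideal is
tightly closed and `g` makes `(C, g, A)` again `𝔪`-primary, then the ideal of `(C, g, A)` is
tightly closed. [cite: HochsterHuneke1994, Thm. 4.2 (d) (CM case, elementary proof)] -/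
theorem isTightlyClosed_exchange (p : ℕ) [Fact p.Prime] {R : Type} [CommRing R] [CharP R p]
    [IsNoetherianRing R] [IsLocalRing R]
    (hCM : ∀ Q : List R, (Q.length : WithBot ℕ∞) = ringKrullDim R →
      (∀ q ∈ Q, q ∈ maximalIdeal R) → (∃ N : ℕ, maximalIdeal R ^ N ≤ Ideal.ofList Q) →
      IsWeaklyRegular R Q)
    (C A : List R) {a g : R}
    (hlen : ((C ++ a :: A).length : WithBot ℕ∞) = ringKrullDim R)
    (hm : ∀ q ∈ C ++ a :: A, q ∈ maximalIdeal R) {N : ℕ}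
    (hN : maximalIdeal R ^ N ≤ Ideal.ofList (C ++ a :: A)) {N' : ℕ}
    (hN' : maximalIdeal R ^ N' ≤ Ideal.ofList (C ++ g :: A))
    (htc : IsTightlyClosed p (Ideal.ofList (C ++ a :: A))) :
    IsTightlyClosed p (Ideal.ofList (C ++ g :: A)) := by
  have hp : p.Prime := Fact.out
  have ha : a ∈ maximalIdeal R := hm a (by simp)
  have hmB : ∀ q ∈ C ++ A, q ∈ maximalIdeal R := fun q hq => hm q (by
    simp only [List.mem_append, List.mem_cons] at hq ⊢; tauto)
  set J : Ideal R := Ideal.ofList (C ++ A) with hJ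
  -- the ideals as `J ⊔ (a)`, `J ⊔ (g)`
  have hJa : Ideal.ofList (C ++ a :: A) = J ⊔ Ideal.span {a} := by
    rw [ofList_append_cons, sup_comm]
  have hJg : Ideal.ofList (C ++ g :: A) = J ⊔ Ideal.span {g} := by
    rw [ofList_append_cons, sup_comm]
  have hNa : maximalIdeal R ^ N ≤ Ideal.ofList ((C ++ A) ++ [a]) := by
    rw [ofList_concat, ← ofList_append_cons]; exact hN
  -- `a` is a non-zero-divisor modulo every `J^[p^e]` (a reordered parameter list of powers)
  have hreg : ∀ (e : ℕ) (z : R), z * a ∈ frobeniusPower (p ^ e) J →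
      z ∈ frobeniusPower (p ^ e) J := by
    intro e z hz
    obtain ⟨M, hM⟩ := exists_pow_le_ofList_map_pow_concat (C ++ A) a hNa (p ^ e)
    have hlen' : (((C ++ A).map (fun x => x ^ p ^ e) ++ [a]).length : WithBot ℕ∞) =
        ringKrullDim R := by
      rw [← hlen]; simp
    have hm' : ∀ q ∈ (C ++ A).map (fun x => x ^ p ^ e) ++ [a], q ∈ maximalIdeal R := by
      intro q hq'
      simp only [List.mem_append, List.mem_map, List.mem_singleton] at hq'
      rcases hq' with ⟨x, hx, rfl⟩ | rfl
      · exact Ideal.pow_mem_of_mem _ (hmB x (List.mem_append.mpr hx)) _ (pow_pos hp.pos e)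
      · exact ha
    rw [hJ, frobeniusPower_ofList] at hz ⊢
    exact socleOne_mem_of_mul_mem hCM _ a hlen' hm' hM z (by rwa [mul_comm] at hz)
  -- power step: `(J, a^M)` tightly closed for all `M`
  have htcJa : IsTightlyClosed p (J ⊔ Ideal.span {a}) := hJa ▸ htc
  have hpow : ∀ M : ℕ, IsTightlyClosed p (J ⊔ Ideal.span {a ^ M}) :=
    stub_tc_power_step p R J a hreg htcJa
  -- `a^N' ∈ (J, g)`: `a^N' = w g + j`
  have haN' : a ^ N' ∈ J ⊔ Ideal.span {g} := by
    rw [← hJg]; exact hN' (Ideal.pow_mem_pow ha N')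
  obtain ⟨j, hj, s, hs, hjs⟩ := Submodule.mem_sup.mp haN'
  obtain ⟨w, rfl⟩ := Ideal.mem_span_singleton'.mp hs
  -- exchange step
  have ha0 : ∀ z : R, z * a ∈ J → z ∈ J := by
    intro z hz
    have h := hreg 0 z (by rwa [pow_zero, frobeniusPower_one])
    rwa [pow_zero, frobeniusPower_one] at h
  rw [hJg]
  exact stub_tc_exchange p R J a g w j N' hj (by rw [← hjs, add_comm]) ha0 (hpow N')

/-- **The exchange chain for tight closedness**: of two parameter lists `C ++ A₁`, `C ++ A₂` with a
common prefix and tails of the same length, the second is tightly closed as soon as the first is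
(induction on the length of the tails, exchanging their first members for a common `g` chosen by
prime avoidance, `socleOne_exists_exchange`). [cite: HochsterHuneke1994, Thm. 4.2 (d) (CM case)] -/
theorem isTightlyClosed_of_append (p : ℕ) [Fact p.Prime] {R : Type} [CommRing R] [CharP R p]
    [IsNoetherianRing R] [IsLocalRing R]
    (hCM : ∀ Q : List R, (Q.length : WithBot ℕ∞) = ringKrullDim R →
      (∀ q ∈ Q, q ∈ maximalIdeal R) → (∃ N : ℕ, maximalIdeal R ^ N ≤ Ideal.ofList Q) →
      IsWeaklyRegular R Q)
    (m : ℕ) : ∀ (C A₁ A₂ : List R), A₁.length = m →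
    A₂.length = m → ((C ++ A₁).length : WithBot ℕ∞) = ringKrullDim R →
    (∀ q ∈ C ++ A₁, q ∈ maximalIdeal R) → (∀ q ∈ C ++ A₂, q ∈ maximalIdeal R) →
    (∀ N₁ N₂ : ℕ, maximalIdeal R ^ N₁ ≤ Ideal.ofList (C ++ A₁) →
      maximalIdeal R ^ N₂ ≤ Ideal.ofList (C ++ A₂) →
    IsTightlyClosed p (Ideal.ofList (C ++ A₁)) → IsTightlyClosed p (Ideal.ofList (C ++ A₂))) := by
  induction m with
  | zero =>
    intro C A₁ A₂ h₁ h₂ _ _ _ _ _ _ _ h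
    rw [List.length_eq_zero_iff.mp h₁] at h
    rwa [List.length_eq_zero_iff.mp h₂]
  | succ m ih =>
    intro C A₁ A₂ h₁ h₂ hlen hm₁ hm₂ N₁ N₂ hN₁ hN₂ htc
    obtain ⟨a₁, A₁', rfl⟩ := List.exists_cons_of_length_eq_add_one h₁
    obtain ⟨a₂, A₂', rfl⟩ := List.exists_cons_of_length_eq_add_one h₂
    simp only [List.length_cons, Nat.add_right_cancel_iff] at h₁ h₂
    have ha₁ : a₁ ∈ maximalIdeal R := hm₁ a₁ (by simp)
    have ha₂ : a₂ ∈ maximalIdeal R := hm₂ a₂ (by simp)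
    have hlen₂ : ((C ++ a₂ :: A₂').length : WithBot ℕ∞) = ringKrullDim R := by
      rw [← hlen]; simp [h₁, h₂]
    have hlt : ∀ A' : List R, A'.length = m →
        ((C ++ A').length : WithBot ℕ∞) < ringKrullDim R := fun A' hA' => by
      rw [← hlen]
      have : (C ++ A').length < (C ++ a₁ :: A₁').length := by simp [hA', h₁]
      exact_mod_cast this
    rw [ofList_append_cons] at hN₁ hN₂
    obtain ⟨g, hg, ⟨M₁, hM₁⟩, ⟨M₂, hM₂⟩⟩ :=
      socleOne_exists_exchange (C ++ A₁') (C ++ A₂') (hlt A₁' h₁) (hlt A₂' h₂) ha₁ ha₂ hN₁ hN₂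
    rw [← ofList_append_cons] at hN₁ hN₂ hM₁ hM₂
    have hmg : ∀ {A' : List R} {a : R}, (∀ q ∈ C ++ a :: A', q ∈ maximalIdeal R) →
        ∀ q ∈ C ++ g :: A', q ∈ maximalIdeal R := fun hm q hq => by
      simp only [List.mem_append, List.mem_cons] at hq
      rcases hq with hq | rfl | hq
      · exact hm q (List.mem_append_left _ hq)
      · exact hg
      · exact hm q (by simp [hq])
    -- `(C, a₁, A₁')` ⇒ `(C, g, A₁')` ⇒ `(C, g, A₂')` (induction) ⇒ `(C, a₂, A₂')`
    have h1 : IsTightlyClosed p (Ideal.ofList (C ++ g :: A₁')) :=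
      isTightlyClosed_exchange p hCM C A₁' hlen hm₁ hN₁ hM₁ htc
    have key := ih (C ++ [g]) A₁' A₂' h₁ h₂
    simp only [List.append_assoc, List.singleton_append] at key
    have h2 : IsTightlyClosed p (Ideal.ofList (C ++ g :: A₂')) :=
      key (by rw [← hlen]; simp) (hmg hm₁) (hmg hm₂) M₁ M₂ hM₁ hM₂ h1
    have hleng : ((C ++ g :: A₂').length : WithBot ℕ∞) = ringKrullDim R := by
      rw [← hlen₂]; simp
    exact isTightlyClosed_exchange p hCM C A₂' hleng (hmg hm₂) hM₂ hN₂ h2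

/-- **ONE TIGHTLY CLOSED PARAMETER IDEAL MAKES ALL OF THEM TIGHTLY CLOSED** (Cohen–Macaulay case of
Hochster–Huneke 1994, Thm. 4.2 (d) / Prop. 6.27 (a); Fedder–Watanabe 1989, §2). Let `(R, 𝔪)` be a
Noetherian local ring of prime characteristic `p` in which every list of `dim R` elements of `𝔪`
generating an `𝔪`-primary ideal is a weakly regular sequence. If the ideal of ONE such parameter
list `Q₁` is tightly closed, then the ideal of EVERY parameter list `Q₂` is tightly closed.
[cite: HochsterHuneke1994, Thm. 4.2 (d); FedderWatanabe1989, §2] -/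
theorem isTightlyClosed_parameterIdeal_of_one (p : ℕ) [Fact p.Prime] (R : Type) [CommRing R]
    [CharP R p] [IsNoetherianRing R] [IsLocalRing R]
    (hCM : ∀ Q : List R, (Q.length : WithBot ℕ∞) = ringKrullDim R →
      (∀ q ∈ Q, q ∈ maximalIdeal R) → (∃ N : ℕ, maximalIdeal R ^ N ≤ Ideal.ofList Q) →
      IsWeaklyRegular R Q)
    (Q₁ Q₂ : List R) (h₁ : (Q₁.length : WithBot ℕ∞) = ringKrullDim R)
    (h₂ : (Q₂.length : WithBot ℕ∞) = ringKrullDim R)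
    (hm₁ : ∀ q ∈ Q₁, q ∈ maximalIdeal R) (hm₂ : ∀ q ∈ Q₂, q ∈ maximalIdeal R)
    (N₁ N₂ : ℕ) (hN₁ : maximalIdeal R ^ N₁ ≤ Ideal.ofList Q₁)
    (hN₂ : maximalIdeal R ^ N₂ ≤ Ideal.ofList Q₂) (htc : IsTightlyClosed p (Ideal.ofList Q₁)) :
    IsTightlyClosed p (Ideal.ofList Q₂) := by
  have hlen : Q₂.length = Q₁.length := by
    have := h₂.trans h₁.symm
    exact_mod_cast this
  have h := isTightlyClosed_of_append p hCM Q₁.length [] Q₁ Q₂ rfl hlen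
    (by simpa using h₁) (by simpa using hm₁) (by simpa using hm₂) N₁ N₂ (by simpa using hN₁)
    (by simpa using hN₂)
  simp only [List.nil_append] at h
  exact h htc

/-- **THE ONE-PARAMETER-IDEAL CRITERION IN THE CRUX'S VOCABULARY.** Let `R` be a Noetherian local
domain of prime characteristic `p` in which every system of parameters (`dim R` elements generating
an ideal with maximal radical) is a weakly regular sequence — the Cohen–Macaulay clause of rung 2
(`FInjectiveMacaulayfication`). If ONE system of parameters `s₀` generates an ideal satisfying the
tight-closure clause (`c ≠ 0`, `c y^q ∈ (s₀)^[q]` for all `q` ⇒ `y ∈ (s₀)`), then EVERY system of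
parameters does: `R` satisfies the F-rational clause of `FRationalModification` /
`FRationalResolution`. So F-rationality of a Cohen–Macaulay model is checked on one parameter ideal
per point. [cite: HochsterHuneke1994, Thm. 4.2 (d); FedderWatanabe1989, §2] -/
theorem fRationalClause_of_one (p : ℕ) [Fact p.Prime] (R : Type) [CommRing R] [IsDomain R]
    [CharP R p] [IsNoetherianRing R] [IsLocalRing R]
    (hCM : ∀ d : ℕ, ringKrullDim R = d → ∀ s : Fin d → R,
      (Ideal.span (Set.range s)).radical.IsMaximal → IsWeaklyRegular R (List.ofFn s))
    {d₀ : ℕ} (hd₀ : ringKrullDim R = d₀) (s₀ : Fin d₀ → R)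
    (hs₀ : (Ideal.span (Set.range s₀)).radical.IsMaximal)
    (htc₀ : ∀ y c : R, c ≠ 0 → (∀ e : ℕ, c * y ^ p ^ e ∈
      Ideal.span ((fun z : R => z ^ p ^ e) '' (Ideal.span (Set.range s₀) : Set R))) →
      y ∈ Ideal.span (Set.range s₀)) :
    ∀ d : ℕ, ringKrullDim R = d → ∀ s : Fin d → R, (Ideal.span (Set.range s)).radical.IsMaximal →
      ∀ y c : R, c ≠ 0 → (∀ e : ℕ, c * y ^ p ^ e ∈
        Ideal.span ((fun z : R => z ^ p ^ e) '' (Ideal.span (Set.range s) : Set R))) →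
        y ∈ Ideal.span (Set.range s) := by
  -- parameter LISTS are weakly regular
  have hCM' : ∀ Q : List R, (Q.length : WithBot ℕ∞) = ringKrullDim R →
      (∀ q ∈ Q, q ∈ maximalIdeal R) → (∃ N : ℕ, maximalIdeal R ^ N ≤ Ideal.ofList Q) →
      IsWeaklyRegular R Q := by
    intro L hL hLm ⟨N, hN⟩
    have hofFn : List.ofFn (fun i : Fin L.length => L.get i) = L := List.ofFn_get L
    have hspan : Ideal.span (Set.range fun i : Fin L.length => L.get i) = Ideal.ofList L := by
      rw [Ideal.ofList, Set.range_list_get]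
    have hrad : (Ideal.span (Set.range fun i : Fin L.length => L.get i)).radical.IsMaximal := by
      rw [hspan]
      have hle : Ideal.ofList L ≤ maximalIdeal R := Ideal.span_le.mpr fun q hq => hLm q hq
      have heq : (Ideal.ofList L).radical = maximalIdeal R := by
        refine le_antisymm ?_ ?_
        · exact (Ideal.radical_mono hle).trans
            ((Ideal.IsPrime.radical_le_iff inferInstance).mpr le_rfl)
        · intro m hm
          exact ⟨N, hN (Ideal.pow_mem_pow hm N)⟩
      rw [heq]
      exact IsLocalRing.maximalIdeal.isMaximal _
    have h := hCM L.length hL.symm (fun i : Fin L.length => L.get i) hrad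
    rwa [hofFn] at h
  -- dictionary between a system of parameters `s` and the list `List.ofFn s`
  have hdict : ∀ {d : ℕ} (s : Fin d → R), ringKrullDim R = d →
      (Ideal.span (Set.range s)).radical.IsMaximal →
      Ideal.ofList (List.ofFn s) = Ideal.span (Set.range s) ∧
      ((List.ofFn s).length : WithBot ℕ∞) = ringKrullDim R ∧
      (∀ q ∈ List.ofFn s, q ∈ maximalIdeal R) ∧
      ∃ N : ℕ, maximalIdeal R ^ N ≤ Ideal.ofList (List.ofFn s) := by
    intro d s hd hs
    have hspan : Ideal.ofList (List.ofFn s) = Ideal.span (Set.range s) := by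
      rw [Ideal.ofList]
      congr 1
      ext q
      simp [List.mem_ofFn']
    have hmax : (Ideal.span (Set.range s)).radical = maximalIdeal R := IsLocalRing.eq_maximalIdeal hs
    refine ⟨hspan, by rw [List.length_ofFn, hd], fun q hq => ?_, ?_⟩
    · rw [← hmax]
      exact Ideal.le_radical (hspan ▸ Ideal.subset_span hq)
    · rw [hspan]
      exact Ideal.exists_pow_le_of_le_radical_of_fg (hmax ▸ le_rfl) (IsNoetherian.noetherian _)
  obtain ⟨hspan₀, hlen₀, hm₀, N₀, hN₀⟩ := hdict s₀ hd₀ hs₀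
  have htc₀' : IsTightlyClosed p (Ideal.ofList (List.ofFn s₀)) := by
    rw [hspan₀]
    exact (isTightlyClosed_iff_of_isDomain p).mpr htc₀
  intro d hd s hs
  obtain ⟨hspan, hlen, hm, N, hN⟩ := hdict s hd hs
  have h := isTightlyClosed_parameterIdeal_of_one p R hCM' (List.ofFn s₀) (List.ofFn s) hlen₀ hlen
    hm₀ hm N₀ N hN₀ hN htc₀'
  rw [hspan] at h
  exact (isTightlyClosed_iff_of_isDomain p).mp h

end Summit.ResolutionOfSingularities.ResolutionOfSingularities.Theorems.FRationalResolution
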